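import Literature.AlgebraicGeometry.Frobenioids.PerfectionBiratCommute
import Literature.AlgebraicGeometry.Frobenioids.Prop55Sub
import HarnessLib

/-!
# [FrdI] Prop. 5.5 (ii), second clause: `(C^pf)^birat ≅ (C^birat)^pf` is an equivalence

[cite: MochizukiFrdI2008, Prop. 5.5 (ii) p.104]

Mochizuki, *The geometry of Frobenioids I*, Prop. 5.5 (ii) and its proof (p. 105 ll. 3–8): "it suffices
to obtain natural bijections between the respective sets of morphisms between the images of two given
objects of `C` in … `(C^pf)^birat`, `(C^birat)^pf`.  But this follows immediately from the definitions,
together with Proposition 3.2, (ii), applied to 'pre-steps' …".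

For THE comparison functor `PerfectionBirat.comparison : (C^pf)^birat → (C^birat)^pf` of
`PerfectionBiratCommute.lean` (identity on objects `(A, n)`) this file proves exactly these bijections:
* **full** (`comparison_full`): a representative `(A^birat)^{(a)} → (B^birat)^{(b)}` at level `(a, b)`
  of a morphism `(A^birat, n) → (B^birat, m)` of `(C^birat)^pf` is, after the comparison isomorphisms
  `(A^{(a)})^birat ≅ (A^birat)^{(a)}`, a class of fractions `[(α : A″ → A^{(a)}, φ′ : A″ → B^{(b)})]`; it is
  the image of the fraction of `(C^pf)^birat` with apex `(A″, n·a)`, denominator `[α]` at level `(1, a)`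
  (a co-angular pre-step of `C^pf`, Prop. 3.2 (ii)) and numerator `[φ′]` at level `(1, b)`;
* **faithful** (`comparison_faithful`): two fractions with a common denominator whose numerators have
  the same image have representatives `A^{(a)} → B^{(b)}` with the same image in `C^birat`, hence
  equalised by a co-angular pre-step of `C` (Prop. 4.4 (ii)), which lifts to a co-angular pre-step of
  `C^pf` at level `(1, a)`;
* **surjective on objects** on the nose (`comparison_essSurj`);
whence the comparison functor is an equivalence (`comparison_isEquivalence`), lying over `D`
(`PerfectionBirat.comparison_comp_base`); the closing theorem `prop55ii_birat` has the shape of the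
sub-statement `FrdI.Prop55Sub.Prop55ii_birat`, whose slot `Prop55ii_birat_holds` is filled at the end
(its Frobenius-isotropy / -normalisation hypotheses, used in print for "WLOG of isotropic type", are
not needed by this construction).
-/

namespace Literature.AlgebraicGeometry.Frobenioids

namespace PreFrobenioid

open CategoryTheory Opposite

universe w v v' u u'

variable {D : Type u} [Category.{v} D] {Φ : Dᵒᵖ ⥤ CommMonCat.{w}}
  {C : Type u'} [Category.{v'} C] {F : C ⥤ ElemFrobenioid Φ}
  {hF : IsFrobenioid F} {hsq : HasBiratSquares F}
  {hBi : IsFrobenioid (biratOps hF hsq).toFunctor}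
  {hPf : IsFrobenioid (Perfection.ops hF).toFunctor}
  {hsq' : HasBiratSquares (Perfection.ops hF).toFunctor}

namespace PerfectionBirat

/-! ### Lifting co-angular pre-steps of `C` to `C^pf` -/

/-- A representative whose arrow is a co-angular pre-step of `C` has a class which is a co-angular
pre-step of `C^pf` (Prop. 3.2 (ii): `C → C^pf` and Frobenius conjugation preserve co-angular arrows and
pre-steps). [cite: MochizukiFrdI2008, Prop. 3.2 (ii) p.59] -/
theorem isCoAngularPreStep_mk_of {X Y : Perfection hF} (r : Perfection.Rep X Y)
    (hr : IsCoAngularPreStep F r.hom) :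
    IsCoAngularPreStep (Perfection.ops hF).toFunctor (A := X) (B := Y) (Perfection.Hom.mk r) :=
  ⟨(PreFrobenioidData.ofFunctor_isCoAngular (Perfection.ops hF).toFunctor _).mp
      (Perfection.isCoAngular_mk_of r hr.1),
    (PreFrobenioidData.isPreStep_toFunctor_iff _ _).mpr ((Perfection.isPreStep_mk_iff r).mpr hr.2)⟩

/-! ### Faithfulness -/

/-- Two morphisms `Z → Y` of `C^pf` with the same image under `P : C^pf → (C^birat)^pf` are equalised by a
co-angular pre-step of `C^pf`: representatives at a common level `(a, b)` have images in `C^birat`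
agreeing after the comparison isomorphisms, hence equal (these are isomorphisms), so (Prop. 4.4 (ii),
`C → C^birat` is "faithful up to co-angular pre-steps") they are equalised by a co-angular pre-step
`ε₀ : E → A^{(a)}` of `C`, and `[frob_E⁻¹ ≫ ε₀] : (E, n·a) → (A, n)` equalises the two morphisms.
[cite: MochizukiFrdI2008, Prop. 5.5 (ii) p.105] -/
theorem exists_coAngularPreStep_comp_eq_of_perfMap_eq {Z Y : Perfection hF} {g₁ g₂ : Z ⟶ Y}
    (h : (perfMap hF hsq hBi).map g₁ = (perfMap hF hsq hBi).map g₂) :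
    ∃ (Z' : Perfection hF) (ε : Z' ⟶ Z),
      IsCoAngularPreStep (Perfection.ops hF).toFunctor ε ∧ ε ≫ g₁ = ε ≫ g₂ := by
  obtain ⟨r₁, rfl⟩ := Perfection.Hom.mk_surjective g₁
  obtain ⟨r₂, rfl⟩ := Perfection.Hom.mk_surjective g₂
  rw [perfMap_map_mk, perfMap_map_mk] at h
  obtain ⟨⟨a, b, eab⟩, h₁, h₂, hM⟩ := Perfection.Hom.mk_eq_mk.mp h
  -- the common level `(a, b)`, read in `C^pf`, and the transported representatives `x₁, x₂ : A^{(a)} → B^{(b)}`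
  have h₁' : r₁.L.LE (⟨a, b, eab⟩ : Perfection.Level Z Y) := ⟨h₁.1, h₁.2⟩
  have h₂' : r₂.L.LE (⟨a, b, eab⟩ : Perfection.Level Z Y) := ⟨h₂.1, h₂.2⟩
  have e₁ := Perfection.repMap_lift (hF₁ := hF) (hF₂ := hBi) (isFrobeniusCompatible_toBirat hF hsq)
    r₁.L ⟨a, b, eab⟩ h₁' r₁.hom
  have e₂ := Perfection.repMap_lift (hF₁ := hF) (hF₂ := hBi) (isFrobeniusCompatible_toBirat hF hsq)
    r₂.L ⟨a, b, eab⟩ h₂' r₂.hom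
  have hx : @Eq (frobPow hBi ((toBirat F hF hsq).obj Z.obj) a ⟶ frobPow hBi ((toBirat F hF hsq).obj Y.obj) b)
      (Perfection.repMap (hF₁ := hF) (hF₂ := hBi) (isFrobeniusCompatible_toBirat hF hsq)
        ⟨⟨a, b, eab⟩, Perfection.Level.lift r₁.L ⟨a, b, eab⟩ h₁' r₁.hom⟩).hom
      (Perfection.repMap (hF₁ := hF) (hF₂ := hBi) (isFrobeniusCompatible_toBirat hF hsq)
        ⟨⟨a, b, eab⟩, Perfection.Level.lift r₂.L ⟨a, b, eab⟩ h₂' r₂.hom⟩).hom := by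
    rw [e₁, e₂]
    exact hM
  -- the images in `C^birat` agree, hence are equalised by a co-angular pre-step `ε₀` of `C`
  rw [Perfection.repMap_hom, Perfection.repMap_hom, cancel_epi, cancel_mono, toBirat_map,
    toBirat_map] at hx
  obtain ⟨E, ε₀, ε₀', hε₀, -, hd, hn⟩ := Birat.homMk_eq_homMk_iff.mp hx
  change E ⟶ frobPow hF Z.obj a at ε₀
  change E ⟶ frobPow hF Z.obj a at ε₀'
  change ε₀ ≫ 𝟙 _ = ε₀' ≫ 𝟙 _ at hd
  rw [Category.comp_id, Category.comp_id] at hd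
  subst hd
  change ε₀ ≫ Perfection.Level.lift r₁.L ⟨a, b, eab⟩ h₁' r₁.hom =
    ε₀ ≫ Perfection.Level.lift r₂.L ⟨a, b, eab⟩ h₂' r₂.hom at hn
  -- lift `ε₀` to `C^pf` at level `(1, a)`
  haveI := Perfection.isIso_frob_one (hF := hF) E
  let Z' : Perfection hF := ⟨E, Z.idx * a⟩
  let T : Perfection.Level₃ Z' Z Y := ⟨1, a, b, mul_one _, eab⟩
  let εr : Perfection.Rep Z' Z := ⟨T.fst, inv (frob hF E 1) ≫ ε₀⟩
  refine ⟨Z', Perfection.Hom.mk εr, isCoAngularPreStep_mk_of εr (hε₀.iso_comp _), ?_⟩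
  rw [Perfection.mk_comp_mk, Perfection.mk_comp_mk,
    ← Perfection.mk_compAt T εr r₁ (Perfection.Level.le_rfl _) h₁',
    ← Perfection.mk_compAt T εr r₂ (Perfection.Level.le_rfl _) h₂']
  change Perfection.Hom.mk ⟨T.out, Perfection.Level.lift T.fst T.fst (Perfection.Level.le_rfl _)
      (inv (frob hF E 1) ≫ ε₀) ≫ Perfection.Level.lift r₁.L ⟨a, b, eab⟩ h₁' r₁.hom⟩ =
    Perfection.Hom.mk ⟨T.out, Perfection.Level.lift T.fst T.fst (Perfection.Level.le_rfl _)
      (inv (frob hF E 1) ≫ ε₀) ≫ Perfection.Level.lift r₂.L ⟨a, b, eab⟩ h₂' r₂.hom⟩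
  rw [Perfection.Level.lift_rfl, Category.assoc, Category.assoc, hn]

/-- **The comparison functor is faithful.**  Two fractions `A ⇠ A′ᵢ → B` of `(C^pf)^birat` are brought
to a common denominator (directedness of the co-angular pre-steps over `A`, Def. 1.3 (iii)(d)); if
their images agree then so do the images of their numerators under `P`, which are then equalised by a
co-angular pre-step of `C^pf`, i.e. the fractions agree. [cite: MochizukiFrdI2008, Prop. 5.5 (ii) p.105] -/
theorem comparison_faithful : (comparison hF hsq hPf hsq' hBi).Faithful where
  map_injective {X Y} := by
    intro f₁ f₂ h
    obtain ⟨f₁, rfl⟩ := Birat.homMk_surjective f₁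
    obtain ⟨f₂, rfl⟩ := Birat.homMk_surjective f₂
    -- common denominators
    obtain ⟨W, κ₁, κ₂, hκ₁, hκ₂, hW⟩ :=
      exists_common_refinement hPf f₁.den f₂.den f₁.den_mem f₂.den_mem
    change (Birat.homMk f₁ : X ⟶ Y) = Birat.homMk f₂
    rw [← Birat.homMk_sound (BiratFrac.rel_restrict hPf f₁ κ₁ hκ₁),
      ← Birat.homMk_sound (BiratFrac.rel_restrict hPf f₂ κ₂ hκ₂)] at h ⊢
    -- the images of the numerators agree
    haveI := perfMap_inverts hBi _ (hκ₁.comp hPf f₁.den_mem)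
    haveI := perfMap_inverts hBi _ (hκ₂.comp hPf f₂.den_mem)
    have ha : (perfMap hF hsq hBi).map (κ₁ ≫ f₁.den) = (perfMap hF hsq hBi).map (κ₂ ≫ f₂.den) :=
      (perfMap hF hsq hBi).congr_map hW
    rw [comparison_map_homMk, comparison_map_homMk] at h
    change inv ((perfMap hF hsq hBi).map (κ₁ ≫ f₁.den)) ≫ (perfMap hF hsq hBi).map (κ₁ ≫ f₁.num) =
      inv ((perfMap hF hsq hBi).map (κ₂ ≫ f₂.den)) ≫ (perfMap hF hsq hBi).map (κ₂ ≫ f₂.num) at h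
    rw [IsIso.inv_comp_eq, ha, IsIso.hom_inv_id_assoc] at h
    -- hence the numerators are equalised by a co-angular pre-step of `C^pf`
    obtain ⟨Z', ε, hε, hεn⟩ := exists_coAngularPreStep_comp_eq_of_perfMap_eq h
    apply Birat.homMk_sound
    refine ⟨Z', ε, ε, hε, hε, ?_, hεn⟩
    change ε ≫ κ₁ ≫ f₁.den = ε ≫ κ₂ ≫ f₂.den
    rw [hW]

/-! ### Fullness -/

/-- **The comparison functor is full.**  A representative `τ : (A^birat)^{(a)} → (B^birat)^{(b)}` of a
morphism `(A^birat, n) → (B^birat, m)` of `(C^birat)^pf` becomes, after the comparison isomorphisms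
`(A^{(a)})^birat ≅ (A^birat)^{(a)}`, a class of fractions `[(α : A″ → A^{(a)}, φ′ : A″ → B^{(b)})]` of
`C`; the fraction of `(C^pf)^birat` with apex `(A″, n·a)`, denominator `[frob⁻¹ ≫ α]` at level `(1, a)`
(a co-angular pre-step of `C^pf`) and numerator `[frob⁻¹ ≫ φ′]` at level `(1, b)` maps to `[τ]`.
[cite: MochizukiFrdI2008, Prop. 5.5 (ii) p.105] -/
theorem comparison_full : (comparison hF hsq hPf hsq' hBi).Full where
  map_surjective {X Y} := by
    change ∀ t : Perfection.objMap (hF₂ := hBi) (toBirat F hF hsq) X.out ⟶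
        Perfection.objMap (hF₂ := hBi) (toBirat F hF hsq) Y.out,
      ∃ g, (comparison hF hsq hPf hsq' hBi).map g = t
    intro t
    obtain ⟨τ, rfl⟩ := Perfection.Hom.mk_surjective t
    -- the fraction `q = (α, φ′)` of `C` representing `jA ≫ τ ≫ jB⁻¹ : (A^{(a)})^birat → (B^{(b)})^birat`
    obtain ⟨q, hq⟩ := Birat.homMk_surjective
      (X := (toBirat F hF hsq).obj (frobPow hF X.out.obj τ.L.a))
      (Y := (toBirat F hF hsq).obj (frobPow hF Y.out.obj τ.L.b))
      ((Perfection.frobPowIso (hF₁ := hF) (hF₂ := hBi) (isFrobeniusCompatible_toBirat hF hsq)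
          X.out.obj τ.L.a).hom ≫ τ.hom ≫
        (Perfection.frobPowIso (hF₁ := hF) (hF₂ := hBi) (isFrobeniusCompatible_toBirat hF hsq)
          Y.out.obj τ.L.b).inv)
    change BiratFrac F (frobPow hF X.out.obj τ.L.a) (frobPow hF Y.out.obj τ.L.b) at q
    have h₁ := toBirat_map_den_comp_homMk hF hsq q
    rw [hq] at h₁
    have hq' : (toBirat F hF hsq).map q.num ≫
        (Perfection.frobPowIso (hF₁ := hF) (hF₂ := hBi) (isFrobeniusCompatible_toBirat hF hsq)
          Y.out.obj τ.L.b).hom =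
      (toBirat F hF hsq).map q.den ≫
        (Perfection.frobPowIso (hF₁ := hF) (hF₂ := hBi) (isFrobeniusCompatible_toBirat hF hsq)
          X.out.obj τ.L.a).hom ≫ τ.hom := by
      rw [← h₁]
      simp only [Category.assoc, Iso.inv_hom_id, Category.comp_id]
    -- the preimage: apex `(A″, n·a)`, denominator `[frob⁻¹ ≫ α]`, numerator `[frob⁻¹ ≫ φ′]`
    haveI := Perfection.isIso_frob_one (hF := hF) q.src
    let Z : Perfection hF := ⟨q.src, X.out.idx * τ.L.a⟩
    let Lδ : Perfection.Level Z X.out := ⟨1, τ.L.a, mul_one _⟩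
    let Lν : Perfection.Level Z Y.out := ⟨1, τ.L.b, by rw [mul_one]; exact τ.L.eq⟩
    let δr : Perfection.Rep Z X.out := ⟨Lδ, inv (frob hF q.src 1) ≫ q.den⟩
    let νr : Perfection.Rep Z Y.out := ⟨Lν, inv (frob hF q.src 1) ≫ q.num⟩
    have hδ := isCoAngularPreStep_mk_of δr (q.den_mem.iso_comp _)
    -- `P[δr] ≫ [τ] = P[νr]`, computed at the triple level `(1, a, b)`
    let T : Perfection.Level₃ (Perfection.objMap (hF₂ := hBi) (toBirat F hF hsq) Z)
        (Perfection.objMap (hF₂ := hBi) (toBirat F hF hsq) X.out)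
        (Perfection.objMap (hF₂ := hBi) (toBirat F hF hsq) Y.out) :=
      ⟨1, τ.L.a, τ.L.b, mul_one _, τ.L.eq⟩
    have key : (Perfection.Hom.mk (Perfection.repMap (hF₁ := hF) (hF₂ := hBi)
          (isFrobeniusCompatible_toBirat hF hsq) δr) ≫ Perfection.Hom.mk τ :
          Perfection.objMap (hF₂ := hBi) (toBirat F hF hsq) Z ⟶
            Perfection.objMap (hF₂ := hBi) (toBirat F hF hsq) Y.out) =
        Perfection.Hom.mk (Perfection.repMap (hF₁ := hF) (hF₂ := hBi)
          (isFrobeniusCompatible_toBirat hF hsq) νr) := by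
      rw [Perfection.mk_comp_mk,
        ← Perfection.mk_compAt T _ τ (Perfection.Level.le_rfl _) (Perfection.Level.le_rfl _)]
      change Perfection.Hom.mk ⟨T.out, Perfection.Level.lift T.fst T.fst (Perfection.Level.le_rfl _)
          (Perfection.repMap (hF₁ := hF) (hF₂ := hBi) (isFrobeniusCompatible_toBirat hF hsq) δr).hom ≫
          Perfection.Level.lift T.snd T.snd (Perfection.Level.le_rfl _) τ.hom⟩ =
        Perfection.Hom.mk ⟨T.out, (Perfection.repMap (hF₁ := hF) (hF₂ := hBi)
          (isFrobeniusCompatible_toBirat hF hsq) νr).hom⟩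
      rw [Perfection.Level.lift_rfl, Perfection.Level.lift_rfl, Perfection.repMap_hom,
        Perfection.repMap_hom]
      change Perfection.Hom.mk ⟨T.out,
          ((Perfection.frobPowIso (hF₁ := hF) (hF₂ := hBi) (isFrobeniusCompatible_toBirat hF hsq)
            q.src 1).inv ≫ (toBirat F hF hsq).map (inv (frob hF q.src 1) ≫ q.den) ≫
          (Perfection.frobPowIso (hF₁ := hF) (hF₂ := hBi) (isFrobeniusCompatible_toBirat hF hsq)
            X.out.obj τ.L.a).hom) ≫ τ.hom⟩ =
        Perfection.Hom.mk ⟨T.out,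
          (Perfection.frobPowIso (hF₁ := hF) (hF₂ := hBi) (isFrobeniusCompatible_toBirat hF hsq)
            q.src 1).inv ≫ (toBirat F hF hsq).map (inv (frob hF q.src 1) ≫ q.num) ≫
          (Perfection.frobPowIso (hF₁ := hF) (hF₂ := hBi) (isFrobeniusCompatible_toBirat hF hsq)
            Y.out.obj τ.L.b).hom⟩
      rw [(toBirat F hF hsq).map_comp, (toBirat F hF hsq).map_comp]
      simp only [Category.assoc]
      rw [hq']
    refine ⟨Birat.homMk ⟨Z, Perfection.Hom.mk δr, Perfection.Hom.mk νr, hδ⟩, ?_⟩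
    haveI := perfMap_inverts hBi _ hδ
    rw [comparison_map_homMk]
    exact (IsIso.inv_comp_eq ((perfMap hF hsq hBi).map (Perfection.Hom.mk δr))).mpr key.symm

/-! ### The equivalence -/

/-- **The comparison functor is (essentially) surjective on objects**: `(A^birat, n)` is the image of
`(A, n)` on the nose. [cite: MochizukiFrdI2008, Prop. 5.5 (ii) p.105] -/
theorem comparison_essSurj : (comparison hF hsq hPf hsq' hBi).EssSurj where
  mem_essImage Y :=
    ⟨Birat.of (Perfection.ops hF).toFunctor hPf hsq' ⟨Y.obj.out, Y.idx⟩, ⟨Iso.refl _⟩⟩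

/-- **[FrdI] Prop. 5.5 (ii), second clause: THE comparison functor `(C^pf)^birat → (C^birat)^pf` is an
equivalence of categories** (full, faithful, surjective on objects — "natural bijections between the
respective sets of morphisms", p. 105). [cite: MochizukiFrdI2008, Prop. 5.5 (ii) p.104] -/
theorem comparison_isEquivalence : (comparison hF hsq hPf hsq' hBi).IsEquivalence :=
  haveI := comparison_faithful (hF := hF) (hsq := hsq) (hPf := hPf) (hsq' := hsq') (hBi := hBi)
  haveI := comparison_full (hF := hF) (hsq := hsq) (hPf := hPf) (hsq' := hsq') (hBi := hBi)
  haveI := comparison_essSurj (hF := hF) (hsq := hsq) (hPf := hPf) (hsq' := hsq') (hBi := hBi)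
  { }

end PerfectionBirat

/-- **[FrdI] Prop. 5.5 (ii), second clause, in the shape of the sub-statement
`FrdI.Prop55Sub.Prop55ii_birat`**: for a Frobenioid `C` [of Frobenius-isotropic, Frobenius-normalized
type — hypotheses of the printed statement, not needed by this construction], with `hPf`, `hBi` the
Frobenioid structures of `C^pf` and `C^birat`, there is an equivalence `(C^pf)^birat ≌ (C^birat)^pf`
(THE comparison functor, as an equivalence) whose functor lies over the base category `D`.
[cite: MochizukiFrdI2008, Prop. 5.5 (ii) p.104] -/
theorem prop55ii_birat (hF : IsFrobenioid F) :
    IsOfType (IsFrobeniusIsotropic F) → IsOfType (IsFrobeniusNormalized F) →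
      ∀ (hPf : IsFrobenioid (Perfection.ops hF).toFunctor)
        (hBi : IsFrobenioid (biratData hF (hasBiratSquares_of_isFrobenioid hF)).ops.toFunctor),
        ∃ e : (biratData hPf (hasBiratSquares_of_isFrobenioid hPf)).Birat ≌
            PreFrobenioid.Perfection hBi,
          Nonempty (e.functor ⋙ (Perfection.ops hBi).base ≅
            (biratData hPf (hasBiratSquares_of_isFrobenioid hPf)).ops.base) :=
  fun _ _ hPf hBi =>
    haveI := PerfectionBirat.comparison_isEquivalence (hF := hF)
      (hsq := hasBiratSquares_of_isFrobenioid hF) (hPf := hPf)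
      (hsq' := hasBiratSquares_of_isFrobenioid hPf) (hBi := hBi)
    ⟨(PerfectionBirat.comparison hF (hasBiratSquares_of_isFrobenioid hF) hPf
        (hasBiratSquares_of_isFrobenioid hPf) hBi).asEquivalence,
      ⟨PerfectionBirat.comparisonCompBaseIso⟩⟩

end PreFrobenioid

/-! ### The slot of `Prop55Sub.lean` -/

namespace FrdI.Prop55Sub

open CategoryTheory Opposite PreFrobenioid

universe w v v' u u'

variable {D : Type u} [Category.{v} D] {Φ : Dᵒᵖ ⥤ CommMonCat.{w}}
  {C : Type u'} [Category.{v'} C] (F : C ⥤ ElemFrobenioid Φ)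

/-- **Row P55-L04 `Prop55ii_birat` DISCHARGED** ([FrdI] Prop. 5.5 (ii), second clause:
`(C^pf)^birat ≌ (C^birat)^pf` over `D`), by THE comparison functor of `PerfectionBiratCommute.lean`.
[cite: MochizukiFrdI2008, Prop. 5.5 (ii) p.104] -/
theorem Prop55ii_birat_holds : ∀ hF : IsFrobenioid F, Prop55ii_birat F hF :=
  fun hF => PreFrobenioid.prop55ii_birat hF

end FrdI.Prop55Sub

end Literature.AlgebraicGeometry.Frobenioids
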